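import Summits.HubbardSuperconductivity.HubbardSuperconductivity.Theses.PolyaSchurPairBoson
import Summits.HubbardSuperconductivity.HubbardSuperconductivity.Theorems.PlaquetteBosonPbInterpolation
import Summits.HubbardSuperconductivity.HubbardSuperconductivity.Theorems.AnisotropyChordChordToOrderXY
import HarnessLib

/-!
# Crux `EasyPlaneCondensate` (stmt-HubbardSuperconductivity-10288; route `PolyaSchurPairBoson`, rank 0,
# auto-crux: the underived target X_bos of the deciding theorem) — BIRTH SKELETON `Lines/birth.lean` (BC3)

THE CRUX (fixed; `Theses/PolyaSchurPairBoson.lean`, decl `EasyPlaneCondensate`, not restated here):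
RP-free easy-plane condensation of 2-D hard-core bosons at EVERY filling — for every anisotropy
`Δ ∈ (−1, 0]` (n.n. repulsion `0 ≤ V < 2J`) and every `ρ ∈ (0, ½]` there are `c > 0`, `M₀` such that for
even `M ≥ M₀` every normalised `N`-boson sector ground state `ψ` of
`H_M(Δ) = xxzHamiltonian 1 (torusGraph 2 M) (−1) Δ` with `ρM² ≤ N ≤ M²/2` has
`c·M⁴ ≤ Re⟨ψ, S⁺_tot S⁻_tot ψ⟩` (the Lieb–Seiringer–Solovej–Yngvason Ch. 11 open problem, in `d = 2`, up
to the Heisenberg edge).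

WHY THE ROUTE'S OWN ENGINE IS NOT THE SKELETON. Inside `PolyaSchurPairBoson` the crux is the consequent
of the LANDED support `PlanarCoherenceAssembly` (`Theorems.PolyaSchurPairBoson.planarCoherenceAssembly_proof`):
`GroundStateStability → StableImpliesPairCoherence → PlanarInsertionDelocalisation → PairKernelSumRule →
SectorPerronXXZ → EasyPlaneCondensate`, and four of the five antecedents are landed (Theorem S
`groundStateStability_proof`, `stableImpliesPairCoherence_proof`, `pairKernelSumRule_proof`,
`sectorPerronXXZ_proof`). The one open antecedent, K1 = `PlanarInsertionDelocalisation`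
(stmt-…-10290, its own crux, rank 3), would give a ONE-stub skeleton — below the BC3 floor — and the
crux-strategist of its `d = 3` twin (stmt-AtomisticToContinuum-9673, `Cruxes/InsertionFieldDelocalisation/
StrategistSplit.lean`, STRATEGY-CENSUS §0) proved the LOSSLESS split
`K1 ⟺ UniformSectorBEC ∧ PairCoherenceCeiling`: the only two-piece cut of K1 consists of sector BEC in
Perron form with a uniform constant (a STRENGTHENING of this very crux — costume) and a hub-freeness
ceiling that is off the critical path. So no admissible ≥ 2-stub skeleton of `EasyPlaneCondensate` runs
through K1; the K1 engine stays available as the parallel 1-step closing (`PlanarCoherenceAssembly`).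

THE LINE (transport from the reflection-positive corner across the `(Δ, ρ)` square
`(−1, 0] × (0, ½]`, cut at its three natural joints; the crux's docstring names it as one of the "three
engines" that can close the shared bosonic statement):

1. `stub_sectorAnchorXY` — THE CORNER (theorem-grade, provable now; verbatim item
   stmt-HubbardSuperconductivity-0977 `AnisotropyChord.SectorAnchorXY` = `PlaquetteBoson.PbXYSectorAnchor`):
   `∃ c > 0, M₀` such that for even `M ≥ M₀` every normalised `S^z_tot = 0` sector ground state of
   `H_M(0)` (the KLS point: pure hard-core bosons at half filling) has `c·M⁴ ≤ Re⟨ψ, S⁺_tot S⁻_tot ψ⟩`.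
   Why true: `Literature.…kennedy_lieb_shastry_xy_ground_holds` (RP + Gaussian domination + KLS sum
   rule, PROVED in the tree, tracial ground-state functional) + "every ground state of the spin-½ XY
   torus is half filled" (LANDED: `Theorems.AnisotropyChord.groundSpace_xyTorus_le_spinZSector_zero`,
   parts 1–3 of 0977, ALSSY 2004 App. A) + sector Perron–Frobenius (`sectorPerronXXZ_proof`). A complete
   proof is recorded as ready to land on 0977 (evidence 2026-08-16/17). Size: L (mostly landed).
2. `stub_chordXY` — Δ-TRANSPORT AT HALF FILLING, THE FIRST BET (verbatim item
   stmt-HubbardSuperconductivity-8146 `AnisotropyChord.ChordXY`, rank 2 of route `AnisotropyChord`): for every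
   even `M ≥ 4`, every `Δ ∈ [−1, 0]`, every normalised `S^z_tot = 0` sector ground states `ψ₀` of `H_M(0)`
   and `ψ` of `H_M(Δ)`: `(1+Δ)·Λ(ψ₀) ≤ Λ(ψ)`, `Λ = Re⟨·, S⁺_tot S⁻_tot ·⟩` — the half-filled condensate
   lies above the chord from the KLS point to the antiferromagnetic point (weak form of concavity of
   `Δ ↦ Λ_M(Δ)`). Why plausibly true: all second differences of `Λ_M(Δ)` negative on 4×4 and √20×√20
   (card anisotropy-chord-xxz), chord margins `Λ(−0.9)/Λ(0) = 0.767, 0.760` vs `0.1` needed; physically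
   planar order is healthy on the whole easy-plane side. Why it might fail: its `d = 1` analogue is FALSE
   (η(Δ) rises ½ → 1 toward the AF point), so no dimension-blind correlation inequality gives it; the
   intended engine (Δ-blind concavity) is compromised on the FM side at `M = ∞` (refuter g2/g3 notes on
   8146), the easy-plane side `[−1, 0]` used here is untouched by that. Size: crux-sized (open problem).
3. `stub_monotoneDepletion` — N-TRANSPORT AT EVERY Δ, THE SECOND BET (verbatim item
   stmt-HubbardSuperconductivity-0904 `PlaquetteBoson.PbMonotoneDepletion`, rank 2 of route `PlaquetteBoson`):
   for every `Δ ∈ [−1, 0]`, eventually in even `M`, for all `1 ≤ N < M²/2` and normalised sector ground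
   states `ψ_N`, `φ_{N+1}`: `N·Λ(φ_{N+1}) ≤ (N+1)·Λ(ψ_N)` — "adding a hard-core boson never raises the
   condensate per particle". Why plausibly true: equality for the ideal lattice gas, exact and strict on
   the complete graph (Tóth 1990 / Penrose 1991), every QMC dome; ED canary `PbMonotoneDepletionXY`
   (stmt-…-10205: 4×4 all `N`, 6×6 `N ≤ 4`, holds). Why it might fail: no monotonicity-in-`N` theorem for
   an interacting lattice gas beyond `K_V`; MONO-type statements fail on some other vertex-transitive
   graphs (BEC census §2); margins on tori are small. Size: crux-sized (new mechanism, no print).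

COMPOSITION `EasyPlaneCondensate_of : EasyPlaneCondensate` (harness skeleton convention A12: concludes the
crux BY NAME, takes no hypotheses, cites the three declared stubs by name; no `sorry` outside the stubs):
stubs 2 + 1 give half-filled planar order `≥ (1+Δ)·c·M⁴` at every `Δ ∈ (−1, 0]` by the LANDED glue
`Theorems.AnisotropyChord.chordToOrderXY_proof` (real arithmetic + existence of a unit `S^z = 0` ground
state at `Δ = 0`, ~80 lines); stub 3 chains the half-filled floor down the filling ladder,
`Λ(N) ≥ (2N/M²)·Λ(M²/2) ≥ 2ρ·(1+Δ)c·M⁴` for `ρM² ≤ N ≤ M²/2`, through normalised ground states of every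
intermediate sector (Perron–Frobenius, `sectorPerronXXZ_proof` of THIS route) by the LANDED glue
`Theorems.PlaquetteBoson.pbInterpolation_proof` (~150 lines, downward induction in `N`), whose consequent
is this crux verbatim. The seam is therefore kernel-checked and non-trivial (≈ 230 landed lines behind two
names); the constant delivered is `c(Δ, ρ) = 2ρ(1+Δ)·c_KLS`, degrading linearly at both edges `Δ → −1⁺`,
`ρ → 0⁺` exactly as the crux's why-might-fail demands ("c(Δ,ρ) must degrade like the canted moment").

DISPROOF USED: no `Cruxes/EasyPlaneCondensate/Disproof.lean` exists (2026-08-17; `ledger crux ls`: no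
workfiles). From the `d = 3` twin of the route's K1 (`…/InsertionFieldDelocalisation/Negative/LoadBearing.lean`):
`insertionFieldDelocalisation_false_without_groundState` and `…_false_without_halfFilling` — the
eigen-equation and the restriction `2N ≤ |Λ|` are load-bearing for any condensation statement of this
family; every stub here keeps both (all states are sector GROUND states; stub 3 requires
`2(N+1) ≤ M²`, stubs 1–2 sit at `S^z = 0`). BEC census filter F1 (dimension test): both bets are FALSE in
`d = 1` and are typed on the 2-torus only — any proof must consume a `d = 2` fact (for stub 1 it is RP /
Gaussian domination, landed). `ledger negatives --problem HubbardSuperconductivity` (2 entries: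
CooperPairDMottWalk breathing self-duality, AposterioriCapRg KLS-order openness) touches none of the stubs.
No stub is an instance refuted by a landed Negative lemma (none exist for this crux or for 0904/8146/0977).

Sources: T. Kennedy, E. H. Lieb, B. S. Shastry, PRL 61 (1988) 2582; K. Kubo, T. Kishi, PRL 61 (1988)
2585; M. Aizenman, E. H. Lieb, R. Seiringer, J. P. Solovej, J. Yngvason, PRA 70 (2004) 023612, App. A;
E. H. Lieb, R. Seiringer, J. P. Solovej, J. Yngvason, *The Mathematics of the Bose Gas* (2005) Ch. 11;
B. Tóth, J. Stat. Phys. 61 (1990) 749; O. Penrose, J. Stat. Phys. 63 (1991) 761; H. Tasaki (2020) §2.4;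
cards `anisotropy-chord-xxz`, `monotone-depletion-interpolation`, `plaquette-boson-kls-anchor`.
No definition is introduced; all statements are over existing declarations.
-/

noncomputable section

-- `dupNamespace`: the summit and the problem are both named `HubbardSuperconductivity` (layout D-0022)
set_option linter.dupNamespace false

namespace Summit.HubbardSuperconductivity.HubbardSuperconductivity.Cruxes.EasyPlaneCondensate.Birth

open Matrix Finset
open Literature.Probability.LatticeModels Literature.MathematicalPhysics.QuantumLattice
open scoped ComplexOrder Matrix

/-! ## The three stubs -/

/-- **STUB 1 `stub_sectorAnchorXY` — THE REFLECTION-POSITIVE CORNER** (theorem-grade, provable now;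
verbatim `AnisotropyChord.SectorAnchorXY` = `PlaquetteBoson.PbXYSectorAnchor`, item
stmt-HubbardSuperconductivity-0977). There are `c > 0` and `M₀` such that for every even `M ≥ M₀` every
normalised `S^z_tot = 0` (half-filled) sector ground state `ψ` of the KLS point
`H_M(0) = xxzHamiltonian 1 (torusGraph 2 M) (-1) 0` (pure hard-core bosons) has
`c·M⁴ ≤ Re⟨ψ, S⁺_tot S⁻_tot ψ⟩`. Kennedy–Lieb–Shastry (1988) (tree:
`kennedy_lieb_shastry_xy_ground_holds`) + every ground state of the XY torus is half filled (landed
`Theorems.AnisotropyChord.groundSpace_xyTorus_le_spinZSector_zero`, ALSSY 2004 App. A) + sector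
Perron–Frobenius (`sectorPerronXXZ_proof`). -/
theorem stub_sectorAnchorXY :
    ∃ c : ℝ, 0 < c ∧ ∃ M₀ : ℕ, ∀ (M : ℕ) [NeZero M], Even M → M₀ ≤ M →
      ∀ (ψ : TensorIndex (TorusSite 2 M) 2 → ℂ),
        ψ ∈ spinZSector (Λ := TorusSite 2 M) 1 0 → star ψ ⬝ᵥ ψ = 1 →
        Matrix.mulVec (xxzHamiltonian 1 (torusGraph 2 M) (-1) 0) ψ =
          ((lowestEnergyInSector 1 (xxzHamiltonian 1 (torusGraph 2 M) (-1) 0) 0 : ℝ) : ℂ) • ψ →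
        c * (M : ℝ) ^ 4 ≤
          (star ψ ⬝ᵥ Matrix.mulVec ((∑ x : TorusSite 2 M, onSite x (spinRaise 1)) *
            (∑ y : TorusSite 2 M, onSite y (spinLower 1))) ψ).re := by
  sorry

/-- **STUB 2 `stub_chordXY` — Δ-TRANSPORT AT HALF FILLING (the chord from the KLS point; THE FIRST BET)**
(verbatim `AnisotropyChord.ChordXY`, item stmt-HubbardSuperconductivity-8146, rank 2 of route
`AnisotropyChord`). For every even `M ≥ 4`, every `Δ ∈ [-1, 0]`, every normalised `S^z_tot = 0` sector
ground state `ψ₀` of `H_M(0)` and `ψ` of `H_M(Δ)`: `(1 + Δ)·Re⟨ψ₀, S⁺_tot S⁻_tot ψ₀⟩ ≤ Re⟨ψ, S⁺_tot S⁻_tot ψ⟩`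
— the half-filled condensate lies above the chord from the KLS point `Δ = 0` to the antiferromagnetic
point `Δ = -1` (where it reads `0 ≤ ‖S⁻_tot ψ‖²`). Not claimed provable now: it implies planar LRO at
every easy-plane anisotropy (open since 1988 beyond `|Δ| ≲ 0.2`); its `d = 1` analogue is false.
Card `anisotropy-chord-xxz` (CD); Kennedy–Lieb–Shastry (1988); Kubo–Kishi (1988). -/
theorem stub_chordXY :
    ∀ (M : ℕ) [NeZero M], Even M → 4 ≤ M → ∀ Δ ∈ Set.Icc (-1:ℝ) 0,
      ∀ (ψ₀ ψ : TensorIndex (TorusSite 2 M) 2 → ℂ),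
        ψ₀ ∈ spinZSector (Λ := TorusSite 2 M) 1 0 → star ψ₀ ⬝ᵥ ψ₀ = 1 →
        Matrix.mulVec (xxzHamiltonian 1 (torusGraph 2 M) (-1) 0) ψ₀ =
          ((lowestEnergyInSector 1 (xxzHamiltonian 1 (torusGraph 2 M) (-1) 0) 0 : ℝ) : ℂ) • ψ₀ →
        ψ ∈ spinZSector (Λ := TorusSite 2 M) 1 0 → star ψ ⬝ᵥ ψ = 1 →
        Matrix.mulVec (xxzHamiltonian 1 (torusGraph 2 M) (-1) Δ) ψ =
          ((lowestEnergyInSector 1 (xxzHamiltonian 1 (torusGraph 2 M) (-1) Δ) 0 : ℝ) : ℂ) • ψ →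
        (1 + Δ) *
            (star ψ₀ ⬝ᵥ Matrix.mulVec ((∑ x : TorusSite 2 M, onSite x (spinRaise 1)) *
              (∑ y : TorusSite 2 M, onSite y (spinLower 1))) ψ₀).re ≤
          (star ψ ⬝ᵥ Matrix.mulVec ((∑ x : TorusSite 2 M, onSite x (spinRaise 1)) *
            (∑ y : TorusSite 2 M, onSite y (spinLower 1))) ψ).re := by
  sorry

/-- **STUB 3 `stub_monotoneDepletion` — N-TRANSPORT AT EVERY ANISOTROPY (monotone depletion; THE SECOND
BET)** (verbatim `PlaquetteBoson.PbMonotoneDepletion`, item stmt-HubbardSuperconductivity-0904, rank 2 of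
route `PlaquetteBoson`). For every `Δ ∈ [-1, 0]` there is `M₀` such that for every even `M ≥ M₀`, every
`1 ≤ N` with `2(N+1) ≤ M²` and all normalised sector ground states `ψ` (`N` bosons, `S^z = N - M²/2`) and
`φ` (`N+1` bosons) of `H_M(Δ)`: `N·Re⟨φ, S⁺_tot S⁻_tot φ⟩ ≤ (N+1)·Re⟨ψ, S⁺_tot S⁻_tot ψ⟩` — adding a
hard-core boson never raises the condensate per particle. Not claimed provable now (new mechanism, no
print; exact on the complete graph: Tóth 1990 / Penrose 1991; ED canary stmt-…-10205 holds on 4×4, 6×6).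
Card `monotone-depletion-interpolation`; Lieb–Seiringer–Solovej–Yngvason (2005) Ch. 11. -/
theorem stub_monotoneDepletion :
    ∀ Δ ∈ Set.Icc (-1:ℝ) 0, ∃ M₀ : ℕ, ∀ (M : ℕ) [NeZero M], Even M → M₀ ≤ M →
      ∀ N : ℕ, 1 ≤ N → 2 * (N + 1) ≤ M ^ 2 →
      ∀ (ψ φ : TensorIndex (TorusSite 2 M) 2 → ℂ),
        ψ ∈ spinZSector (Λ := TorusSite 2 M) 1 ((N : ℝ) - (M : ℝ) ^ 2 / 2) → star ψ ⬝ᵥ ψ = 1 →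
        Matrix.mulVec (xxzHamiltonian 1 (torusGraph 2 M) (-1) Δ) ψ =
          ((lowestEnergyInSector 1 (xxzHamiltonian 1 (torusGraph 2 M) (-1) Δ)
            ((N : ℝ) - (M : ℝ) ^ 2 / 2) : ℝ) : ℂ) • ψ →
        φ ∈ spinZSector (Λ := TorusSite 2 M) 1 ((N : ℝ) + 1 - (M : ℝ) ^ 2 / 2) → star φ ⬝ᵥ φ = 1 →
        Matrix.mulVec (xxzHamiltonian 1 (torusGraph 2 M) (-1) Δ) φ =
          ((lowestEnergyInSector 1 (xxzHamiltonian 1 (torusGraph 2 M) (-1) Δ)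
            ((N : ℝ) + 1 - (M : ℝ) ^ 2 / 2) : ℝ) : ℂ) • φ →
        (N : ℝ) *
            (star φ ⬝ᵥ Matrix.mulVec ((∑ x : TorusSite 2 M, onSite x (spinRaise 1)) *
              (∑ y : TorusSite 2 M, onSite y (spinLower 1))) φ).re ≤
          ((N : ℝ) + 1) *
            (star ψ ⬝ᵥ Matrix.mulVec ((∑ x : TorusSite 2 M, onSite x (spinRaise 1)) *
              (∑ y : TorusSite 2 M, onSite y (spinLower 1))) ψ).re := by
  sorry

/-! ## The composition: the three stubs imply the crux, by name -/

/-- **`EasyPlaneCondensate_of`** — the composition `stub_sectorAnchorXY → stub_chordXY →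
stub_monotoneDepletion → PolyaSchurPairBoson.EasyPlaneCondensate` in the harness skeleton convention
(A12: concludes the crux BY NAME, takes no hypotheses, cites the DECLARED stubs by name; its only
`sorryAx` dependence is through them). Δ-transport: the chord (stub 2) and the corner (stub 1) give
half-filled planar order `≥ (1+Δ)·c·M⁴` at every `Δ ∈ (-1, 0]` — the landed glue
`Theorems.AnisotropyChord.chordToOrderXY_proof` (its conclusion `AnisotropyChord.HalfFilledOrder` is
`PlaquetteBoson.PbHalfFilledXYOrder` verbatim, item 0906). N-transport: monotone depletion (stub 3)
chains that floor down the filling ladder through normalised ground states of every intermediate sector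
(Perron–Frobenius, `sectorPerronXXZ_proof`), `Λ(N) ≥ (2N/M²)·Λ(M²/2) ≥ 2ρ(1+Δ)c·M⁴` for
`ρM² ≤ N ≤ M²/2` — the landed glue `Theorems.PlaquetteBoson.pbInterpolation_proof`, whose consequent is
this crux verbatim. [folklore] -/
theorem EasyPlaneCondensate_of :
    Summit.HubbardSuperconductivity.HubbardSuperconductivity.Theses.PolyaSchurPairBoson.EasyPlaneCondensate := by
  intro Δ hΔ ρ hρ
  -- (i) Δ-transport at half filling: chord (STUB 2) + corner (STUB 1) ⇒ half-filled order on (-1, 0]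
  have hHF : Summit.HubbardSuperconductivity.HubbardSuperconductivity.Theses.PlaquetteBoson.PbHalfFilledXYOrder :=
    Summit.HubbardSuperconductivity.HubbardSuperconductivity.Theorems.AnisotropyChord.chordToOrderXY_proof
      stub_chordXY stub_sectorAnchorXY
  -- (ii) N-transport: monotone depletion (STUB 3) chains the half-filled floor down to filling `ρ`
  exact Summit.HubbardSuperconductivity.HubbardSuperconductivity.Theorems.PlaquetteBoson.pbInterpolation_proof
    stub_monotoneDepletion hHF Δ hΔ ρ hρ

end Summit.HubbardSuperconductivity.HubbardSuperconductivity.Cruxes.EasyPlaneCondensate.Birth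

end
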